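import Literature.NumberTheory.Transcendental.ShuffleAlgebra
import HarnessLib

/-!
# The shuffle algebra on finite sums of words, with an extra commutative monoid of exponents

Definitions-and-proofs file (Literature, `NumberTheory/Transcendental`), written for the formalisation
of §2 of F. Brown, *Mixed Tate motives over ℤ* (2012) (`BrownMotivicGaloisData.lean`,
`BrownMotivicMZVOfGaloisData.lean`), which needs GENUINE commutative `ℚ`-algebra structures on

* `𝒰 = ℚ⟨f₃, f₅, …⟩ ⊗_ℚ ℚ[f₂]` (Brown 2012, (2.21)–(2.22): shuffle product on the words in the
  `f_{2r+1}`, `f₂` a commuting polynomial variable), compatible with the coordinates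
  `ℕ × List ℕ →₀ ℚ` of `BrownDepthOneLift.lean` (`uWeight`, `dU`), and
* `𝒰 ⊗_ℚ 𝒪(₀Π₁) = 𝒰 ⊗ ℚ⟨e⁰, e¹⟩` (coefficients in `𝒰`, shuffle product on binary words), the
  target of the motivic coaction written in coordinates.

Both are instances of ONE construction, the **shuffle monoid algebra**
`ShuffleMonoidAlgebra M α R` (a one-field structure around `(M × List α) →₀ R`) over a
commutative ring `R`: finite `R`-linear combinations of symbols `X^m · w` (`m` in an additive
commutative monoid `M`, `w` a word in the alphabet `α`) with the product
`(X^m · u) (X^{m'} · v) = X^{m+m'} · (u ш v)`, `u ш v = Σ_{w ∈ u ш v} w` the shuffle product of words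
listed with multiplicity by the tree's `MZV.shuffleWord` (`MZVWordShuffle.lean`). It is the
(non-completed) monoid ring of `M` over the shuffle algebra, `R⟨α⟩_ш[M]` [Reutenauer1993, §1.4]; the
tree's `ShuffleAlgebra α R` (`ShuffleAlgebra.lean`) is the COMPLETED shuffle algebra (all functions
on words), which has no `M` and on which characters cannot be evaluated (infinite sums), whence
this finitely supported variant.

## Contents (everything proved, no named fact)

* `MZV.shuffleWord_perm_swap`, `MZV.shuffleWord_flatMap_perm` — commutativity and associativity of
  the shuffle product of words AS MULTISETS (`List.Perm`), read off from the commutative ring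
  `ShuffleAlgebra α ℤ` of the tree by counting (`ShuffleAlgebra.list_sum_map_word_apply`).
* `ShuffleMonoidAlgebra M α R`: `AddCommGroup`, `Module R`, the linear equivalence `toFinsuppL`
  with the coordinates, the bilinear product `mulLin` with `single_mul_single`, and the `CommRing`
  and `Algebra R` structures (`instCommRing`, `instAlgebra`); basis vectors `e m w` with `e_mul_e`,
  `one_def`.
* `lift` — the universal property used twice downstream: a "table character"
  `f : M × List α → A` into a commutative `R`-algebra (`f (0, ∅) = 1`,
  `f (m, u) f (m', v) = Σ_{w ∈ u ш v} f (m + m', w)`) extends to an `R`-algebra homomorphism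
  (`lift_single`, `lift_e`).
* `D b` — "remove the initial letter `b`" (`(D b x)(m, w) = x(m, b w)`), a DERIVATION (`D_mul`), the
  operator `∂_{2r+1}` of Brown's Lemma 2.7 (`BrownDepthOneLift.dU`) in this generality.
* `exists_of_mul_apply_ne_zero` — a nonzero coefficient of a product sits at a shuffle of the
  supports (for gradings).

## References

* C. Reutenauer, *Free Lie algebras*, London Math. Soc. Monographs 7, Oxford (1993), §1.4 (the
  shuffle algebra, its commutativity and associativity). [Reutenauer1993]
* F. Brown, *Mixed Tate motives over ℤ*, Ann. of Math. **175** (2012), 949–976, (2.20)–(2.22)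
  (`𝒰' = ℚ⟨f₃,f₅,…⟩` with the shuffle product, `𝒰 = 𝒰' ⊗ ℚ[f₂]`). [Brown2012]
-/

noncomputable section

open scoped BigOperators

namespace Literature.NumberTheory.Transcendental

universe u v w

/-! ## The shuffle product of words as a multiset: commutativity and associativity -/

namespace ShuffleAlgebra

variable {α : Type u} [DecidableEq α]

/-- A sum of words of the completed shuffle algebra over `ℤ`, evaluated at a word `t`, counts the
occurrences of `t`. [folklore] -/
theorem list_sum_map_word_apply (L : List (List α)) (t : List α) :
    ((L.map word).sum : ShuffleAlgebra α ℤ) t = (L.count t : ℤ) := by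
  induction L with
  | nil => simp
  | cons s L ih =>
    rw [List.map_cons, List.sum_cons, add_apply, ih, List.count_cons, word_apply]
    by_cases h : s = t
    · subst h; simp [add_comm]
    · simp [h, Ne.symm h]

/-- Mapping then summing over a `flatMap` is the iterated sum. [folklore] -/
theorem sum_map_flatMap {β γ : Type*} {N : Type*} [AddMonoid N] (L : List β) (g : β → List γ)
    (f : γ → N) : ((L.flatMap g).map f).sum = (L.map fun b => ((g b).map f).sum).sum := by
  induction L with
  | nil => simp
  | cons b L ih => rw [List.flatMap_cons, List.map_append, List.sum_append, ih, List.map_cons,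
      List.sum_cons]

/-- `(Σ_{s ∈ L} s) ш c`, summed over a list of words `L`, evaluated: the count in the `flatMap`.
[folklore] -/
theorem list_sum_map_word_mul_word_apply (L : List (List α)) (c t : List α) :
    (((L.map word).sum * word c : ShuffleAlgebra α ℤ)) t =
      ((L.flatMap fun s => MZV.shuffleWord s c).count t : ℤ) := by
  rw [← list_sum_map_word_apply, sum_map_flatMap, ← List.sum_map_mul_right,
    show (L.map fun s => word s * word c) =
        L.map fun s => ((MZV.shuffleWord s c).map word).sum from
      List.map_congr_left fun s _ => word_mul_word s c]

/-- `a ш (Σ_{s ∈ L} s)` evaluated: the count in the `flatMap`. [folklore] -/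
theorem word_mul_list_sum_map_word_apply (a : List α) (L : List (List α)) (t : List α) :
    ((word a * (L.map word).sum : ShuffleAlgebra α ℤ)) t =
      ((L.flatMap fun s => MZV.shuffleWord a s).count t : ℤ) := by
  rw [← list_sum_map_word_apply, sum_map_flatMap, ← List.sum_map_mul_left,
    show (L.map fun s => word a * word s) =
        L.map fun s => ((MZV.shuffleWord a s).map word).sum from
      List.map_congr_left fun s _ => word_mul_word a s]

end ShuffleAlgebra

namespace MZV

variable {α : Type u}

/-- **The shuffle product of words is commutative as a multiset**: `u ш v` and `v ш u` list the same
words with the same multiplicities. [cite: Reutenauer1993, §1.4] -/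
theorem shuffleWord_perm_swap (a b : List α) : (shuffleWord a b).Perm (shuffleWord b a) := by
  classical
  rw [List.perm_iff_count]
  intro t
  have h := congrArg (fun f : ShuffleAlgebra α ℤ => f t)
    (mul_comm (ShuffleAlgebra.word a : ShuffleAlgebra α ℤ) (ShuffleAlgebra.word b))
  simp only [ShuffleAlgebra.word_mul_word, ShuffleAlgebra.list_sum_map_word_apply] at h
  exact_mod_cast h

/-- **The shuffle product of words is associative as a multiset**: `(a ш b) ш c` and `a ш (b ш c)`
list the same words with the same multiplicities. [cite: Reutenauer1993, §1.4] -/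
theorem shuffleWord_flatMap_perm (a b c : List α) :
    ((shuffleWord a b).flatMap fun s => shuffleWord s c).Perm
      ((shuffleWord b c).flatMap fun s => shuffleWord a s) := by
  classical
  rw [List.perm_iff_count]
  intro t
  have h := congrArg (fun f : ShuffleAlgebra α ℤ => f t)
    (mul_assoc (ShuffleAlgebra.word a : ShuffleAlgebra α ℤ) (ShuffleAlgebra.word b)
      (ShuffleAlgebra.word c))
  simp only [ShuffleAlgebra.word_mul_word a b, ShuffleAlgebra.word_mul_word b c,
    ShuffleAlgebra.list_sum_map_word_mul_word_apply,
    ShuffleAlgebra.word_mul_list_sum_map_word_apply] at h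
  exact_mod_cast h

end MZV

/-! ## The shuffle monoid algebra -/

/-- The **shuffle monoid algebra** `R⟨α⟩_ш[M]`: finite `R`-linear combinations of symbols
`X^m · w`, `m ∈ M` (an additive commutative monoid), `w` a word in the alphabet `α` — a one-field
structure around the finitely supported coefficient function `(M × List α) →₀ R` — to be equipped
with the product `(X^m · u)(X^{m'} · v) = X^{m+m'} · (u ш v)`. For `M = ℕ`, `α = ℕ` (letter `2r+1` =
`f_{2r+1}`, `X = f₂`), `R = ℚ` this is Brown's `𝒰 = ℚ⟨f₃,f₅,…⟩ ⊗ ℚ[f₂]` with the coordinates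
`ℕ × List ℕ →₀ ℚ` of `BrownDepthOneLift`. [cite: Reutenauer1993, §1.4] -/
structure ShuffleMonoidAlgebra (M : Type u) (α : Type v) (R : Type w) [CommRing R] :
    Type (max u v w) where
  /-- The element with the given coefficient function. -/
  ofFinsupp ::
  /-- The coefficient function `(m, w) ↦ [X^m · w] x`. -/
  toFinsupp : (M × List α) →₀ R

namespace ShuffleMonoidAlgebra

variable {M : Type u} {α : Type v} {R : Type w} [CommRing R]

/-- `toFinsupp` is injective. [folklore] -/
theorem toFinsupp_injective :
    Function.Injective (toFinsupp : ShuffleMonoidAlgebra M α R → (M × List α) →₀ R) := by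
  rintro ⟨x⟩ ⟨y⟩ h
  congr

/-- Elements are (finitely supported) functions on `M × List α`. [folklore] -/
instance instFunLike : FunLike (ShuffleMonoidAlgebra M α R) (M × List α) R where
  coe x := x.toFinsupp
  coe_injective _ _ h := toFinsupp_injective (DFunLike.coe_injective h)

/-- `x p = x.toFinsupp p`. [folklore] -/
@[simp] theorem toFinsupp_apply (x : ShuffleMonoidAlgebra M α R) (p : M × List α) :
    x.toFinsupp p = x p := rfl

/-- Two elements are equal iff their coefficients are. [folklore] -/
@[ext] theorem ext {x y : ShuffleMonoidAlgebra M α R} (h : ∀ p, x p = y p) : x = y :=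
  DFunLike.ext _ _ h

/-- Coefficientwise zero. [folklore] -/
instance instZero : Zero (ShuffleMonoidAlgebra M α R) := ⟨⟨0⟩⟩
/-- Coefficientwise addition. [folklore] -/
instance instAdd : Add (ShuffleMonoidAlgebra M α R) := ⟨fun x y => ⟨x.toFinsupp + y.toFinsupp⟩⟩
/-- Coefficientwise negation. [folklore] -/
instance instNeg : Neg (ShuffleMonoidAlgebra M α R) := ⟨fun x => ⟨-x.toFinsupp⟩⟩
/-- Coefficientwise subtraction. [folklore] -/
instance instSub : Sub (ShuffleMonoidAlgebra M α R) := ⟨fun x y => ⟨x.toFinsupp - y.toFinsupp⟩⟩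
/-- Coefficientwise `ℕ`-multiples. [folklore] -/
instance instSMulNat : SMul ℕ (ShuffleMonoidAlgebra M α R) := ⟨fun n x => ⟨n • x.toFinsupp⟩⟩
/-- Coefficientwise `ℤ`-multiples. [folklore] -/
instance instSMulInt : SMul ℤ (ShuffleMonoidAlgebra M α R) := ⟨fun n x => ⟨n • x.toFinsupp⟩⟩
/-- Coefficientwise scalar multiplication. [folklore] -/
instance instSMul : SMul R (ShuffleMonoidAlgebra M α R) := ⟨fun r x => ⟨r • x.toFinsupp⟩⟩

/-- Coefficientwise additive group structure. [folklore] -/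
instance instAddCommGroup : AddCommGroup (ShuffleMonoidAlgebra M α R) :=
  toFinsupp_injective.addCommGroup _ rfl (fun _ _ => rfl) (fun _ => rfl) (fun _ _ => rfl)
    (fun _ _ => rfl) (fun _ _ => rfl)

/-- `toFinsupp` as an additive homomorphism. [folklore] -/
def toFinsuppAddHom : ShuffleMonoidAlgebra M α R →+ ((M × List α) →₀ R) where
  toFun := toFinsupp
  map_zero' := rfl
  map_add' _ _ := rfl

/-- Coefficientwise `R`-module structure. [folklore] -/
instance instModule : Module R (ShuffleMonoidAlgebra M α R) :=
  toFinsupp_injective.module R toFinsuppAddHom (fun _ _ => rfl)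

/-- The zero element. [folklore] -/
instance instInhabited : Inhabited (ShuffleMonoidAlgebra M α R) := ⟨0⟩

/-- `(0).toFinsupp = 0`. [folklore] -/
@[simp] theorem toFinsupp_zero : (0 : ShuffleMonoidAlgebra M α R).toFinsupp = 0 := rfl
/-- `(x + y).toFinsupp = x.toFinsupp + y.toFinsupp`. [folklore] -/
@[simp] theorem toFinsupp_add (x y : ShuffleMonoidAlgebra M α R) :
    (x + y).toFinsupp = x.toFinsupp + y.toFinsupp := rfl
/-- `(-x).toFinsupp = -x.toFinsupp`. [folklore] -/
@[simp] theorem toFinsupp_neg (x : ShuffleMonoidAlgebra M α R) : (-x).toFinsupp = -x.toFinsupp := rfl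
/-- `(r • x).toFinsupp = r • x.toFinsupp`. [folklore] -/
@[simp] theorem toFinsupp_smul (r : R) (x : ShuffleMonoidAlgebra M α R) :
    (r • x).toFinsupp = r • x.toFinsupp := rfl
/-- `(0)(p) = 0`. [folklore] -/
@[simp] theorem zero_apply (p : M × List α) : (0 : ShuffleMonoidAlgebra M α R) p = 0 := rfl
/-- `(x + y)(p) = x(p) + y(p)`. [folklore] -/
@[simp] theorem add_apply (x y : ShuffleMonoidAlgebra M α R) (p : M × List α) :
    (x + y) p = x p + y p := rfl
/-- `(-x)(p) = -x(p)`. [folklore] -/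
@[simp] theorem neg_apply (x : ShuffleMonoidAlgebra M α R) (p : M × List α) : (-x) p = -x p := rfl
/-- `(x - y)(p) = x(p) - y(p)`. [folklore] -/
@[simp] theorem sub_apply (x y : ShuffleMonoidAlgebra M α R) (p : M × List α) :
    (x - y) p = x p - y p := rfl
/-- `(r • x)(p) = r x(p)`. [folklore] -/
@[simp] theorem smul_apply (r : R) (x : ShuffleMonoidAlgebra M α R) (p : M × List α) :
    (r • x) p = r * x p := rfl

/-- **The coordinates**: the underlying finitely supported function, as a linear equivalence.
[folklore] -/
def toFinsuppL : ShuffleMonoidAlgebra M α R ≃ₗ[R] ((M × List α) →₀ R) where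
  toFun := toFinsupp
  invFun := ofFinsupp
  map_add' _ _ := rfl
  map_smul' _ _ := rfl
  left_inv _ := rfl
  right_inv _ := rfl

/-- `toFinsuppL x = x.toFinsupp`. [folklore] -/
@[simp] theorem toFinsuppL_apply (x : ShuffleMonoidAlgebra M α R) : toFinsuppL x = x.toFinsupp :=
  rfl

/-- `toFinsuppL.symm f = ⟨f⟩`. [folklore] -/
@[simp] theorem toFinsuppL_symm_apply (f : (M × List α) →₀ R) :
    (toFinsuppL (M := M) (α := α) (R := R)).symm f = ofFinsupp f := rfl

/-- A finite sum, evaluated at `p`. [folklore] -/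
theorem finset_sum_apply {ι : Type*} (s : Finset ι) (f : ι → ShuffleMonoidAlgebra M α R)
    (p : M × List α) : (∑ i ∈ s, f i) p = ∑ i ∈ s, f i p := by
  classical
  induction s using Finset.induction_on with
  | empty => rfl
  | insert i s hi ih => rw [Finset.sum_insert hi, Finset.sum_insert hi, add_apply, ih]

/-- A list sum, evaluated at `p`. [folklore] -/
theorem list_sum_apply {ι : Type*} (L : List ι) (f : ι → ShuffleMonoidAlgebra M α R)
    (p : M × List α) : (L.map f).sum p = (L.map fun i => f i p).sum := by
  induction L with
  | nil => rfl
  | cons i L ih => rw [List.map_cons, List.sum_cons, add_apply, ih, List.map_cons, List.sum_cons]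

/-! ### Symbols and basis vectors -/

/-- The symbol `r X^m · w` (`p = (m, w)`): the element with the single coefficient `r` at `p`.
[folklore] -/
def single (p : M × List α) (r : R) : ShuffleMonoidAlgebra M α R := ⟨Finsupp.single p r⟩

/-- `(single p r).toFinsupp = Finsupp.single p r`. [folklore] -/
@[simp] theorem toFinsupp_single (p : M × List α) (r : R) :
    (single p r).toFinsupp = Finsupp.single p r := rfl

/-- The coefficients of `single p r`. [folklore] -/
theorem single_apply [DecidableEq M] [DecidableEq α] (p : M × List α) (r : R) (q : M × List α) :
    single p r q = if p = q then r else 0 := by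
  rw [← toFinsupp_apply, toFinsupp_single, Finsupp.single_apply]

/-- `single p r (p) = r`. [folklore] -/
@[simp] theorem single_apply_self (p : M × List α) (r : R) : single p r p = r := by
  classical rw [single_apply, if_pos rfl]

/-- `single p r (q) = 0` for `q ≠ p`. [folklore] -/
theorem single_apply_of_ne {p q : M × List α} (h : p ≠ q) (r : R) : single p r q = 0 := by
  classical rw [single_apply, if_neg h]

/-- `single p 0 = 0`. [folklore] -/
@[simp] theorem single_zero (p : M × List α) : (single p 0 : ShuffleMonoidAlgebra M α R) = 0 :=
  toFinsupp_injective (by simp)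

/-- `single p (r + s) = single p r + single p s`. [folklore] -/
theorem single_add (p : M × List α) (r s : R) :
    (single p (r + s) : ShuffleMonoidAlgebra M α R) = single p r + single p s :=
  toFinsupp_injective (by simp [Finsupp.single_add])

/-- `s • single p r = single p (s r)`. [folklore] -/
theorem smul_single (s : R) (p : M × List α) (r : R) :
    s • (single p r : ShuffleMonoidAlgebra M α R) = single p (s * r) :=
  toFinsupp_injective (by simp [Finsupp.smul_single])

/-- The basis vector `X^m · w`. [folklore] -/
def e (m : M) (w : List α) : ShuffleMonoidAlgebra M α R := single (m, w) 1

/-- `e m w = single (m, w) 1`. [folklore] -/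
theorem e_def (m : M) (w : List α) : (e m w : ShuffleMonoidAlgebra M α R) = single (m, w) 1 := rfl

/-- `r • e m w = single (m, w) r`. [folklore] -/
theorem smul_e (r : R) (m : M) (w : List α) :
    r • (e m w : ShuffleMonoidAlgebra M α R) = single (m, w) r := by
  rw [e_def, smul_single, mul_one]

/-- **Linear induction**: it suffices to check additive statements on the symbols `single p r`.
[folklore] -/
theorem induction_linear {P : ShuffleMonoidAlgebra M α R → Prop} (x : ShuffleMonoidAlgebra M α R)
    (h0 : P 0) (hadd : ∀ x y, P x → P y → P (x + y)) (hsingle : ∀ p r, P (single p r)) : P x := by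
  obtain ⟨f⟩ := x
  induction f using Finsupp.induction_linear with
  | zero => exact h0
  | add f g hf hg => exact hadd ⟨f⟩ ⟨g⟩ hf hg
  | single p r => exact hsingle p r

/-- An element is the sum of its symbols: `x = Σ_{p ∈ supp x} single p (x p)`. [folklore] -/
theorem sum_single (x : ShuffleMonoidAlgebra M α R) :
    ∑ p ∈ x.toFinsupp.support, single p (x p) = x := by
  apply toFinsupp_injective
  rw [show (∑ p ∈ x.toFinsupp.support, single p (x p)).toFinsupp =
      ∑ p ∈ x.toFinsupp.support, (single p (x p)).toFinsupp from map_sum toFinsuppAddHom _ _]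
  simp only [toFinsupp_single, ← toFinsupp_apply]
  exact x.toFinsupp.sum_single

/-- Two linear maps agreeing on the symbols are equal. [folklore] -/
theorem linearMap_ext {N : Type*} [AddCommMonoid N] [Module R N]
    {f g : ShuffleMonoidAlgebra M α R →ₗ[R] N} (h : ∀ p r, f (single p r) = g (single p r)) :
    f = g := by
  refine LinearMap.ext fun x => ?_
  induction x using ShuffleMonoidAlgebra.induction_linear with
  | h0 => rw [map_zero, map_zero]
  | hadd x y hx hy => rw [map_add, map_add, hx, hy]
  | hsingle p r => exact h p r

/-! ### The product -/

variable [AddCommMonoid M]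

/-- The product of two basis vectors: `(X^m · u)(X^{m'} · v) = Σ_{w ∈ u ш v} X^{m+m'} · w`.
[cite: Reutenauer1993, §1.4] -/
def mulBasis (p q : M × List α) : ShuffleMonoidAlgebra M α R :=
  ((MZV.shuffleWord p.2 q.2).map fun w => (e (p.1 + q.1) w : ShuffleMonoidAlgebra M α R)).sum

/-- Right multiplication by the basis vector `p`, extended linearly in the second variable.
[folklore] -/
def mulRight (p : M × List α) : ShuffleMonoidAlgebra M α R →ₗ[R] ShuffleMonoidAlgebra M α R :=
  (Finsupp.lsum R fun q =>
    LinearMap.toSpanSingleton R (ShuffleMonoidAlgebra M α R) (mulBasis p q)) ∘ₗ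
    toFinsuppL.toLinearMap

/-- `mulRight p (single q s) = s • mulBasis p q`. [folklore] -/
theorem mulRight_single (p q : M × List α) (s : R) :
    mulRight p (single q s) = s • (mulBasis p q : ShuffleMonoidAlgebra M α R) := by
  rw [mulRight, LinearMap.comp_apply, LinearEquiv.coe_toLinearMap, toFinsuppL_apply,
    toFinsupp_single, Finsupp.lsum_single, LinearMap.toSpanSingleton_apply]

/-- **The product as a bilinear map**, `single p r ⊗ single q s ↦ (r s) · mulBasis p q`.
[cite: Reutenauer1993, §1.4] -/
def mulLin : ShuffleMonoidAlgebra M α R →ₗ[R]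
    ShuffleMonoidAlgebra M α R →ₗ[R] ShuffleMonoidAlgebra M α R :=
  (Finsupp.lsum R fun p => LinearMap.toSpanSingleton R _ (mulRight p)) ∘ₗ toFinsuppL.toLinearMap

/-- `mulLin (single p r) = r • mulRight p`. [folklore] -/
theorem mulLin_single (p : M × List α) (r : R) :
    mulLin (single p r) = r • (mulRight p : ShuffleMonoidAlgebra M α R →ₗ[R] _) := by
  rw [mulLin, LinearMap.comp_apply, LinearEquiv.coe_toLinearMap, toFinsuppL_apply,
    toFinsupp_single, Finsupp.lsum_single, LinearMap.toSpanSingleton_apply]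

/-- The multiplication of the shuffle monoid algebra. [cite: Reutenauer1993, §1.4] -/
instance instMul : Mul (ShuffleMonoidAlgebra M α R) := ⟨fun x y => mulLin x y⟩

/-- `x * y = mulLin x y`. [folklore] -/
theorem mul_def (x y : ShuffleMonoidAlgebra M α R) : x * y = mulLin x y := rfl

/-- **Product of symbols**: `single p r * single q s = (r s) · Σ_{w ∈ p₂ ш q₂} X^{p₁+q₁} · w`.
[cite: Reutenauer1993, §1.4] -/
theorem single_mul_single (p q : M × List α) (r s : R) :
    single p r * single q s = (r * s) • (mulBasis p q : ShuffleMonoidAlgebra M α R) := by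
  rw [mul_def, mulLin_single, LinearMap.smul_apply, mulRight_single, smul_smul]

/-- **Product of basis vectors**: `e m u * e m' v = Σ_{w ∈ u ш v} e (m + m') w`.
[cite: Reutenauer1993, §1.4] -/
theorem e_mul_e (m m' : M) (u v : List α) :
    (e m u * e m' v : ShuffleMonoidAlgebra M α R) =
      ((MZV.shuffleWord u v).map fun w => (e (m + m') w : ShuffleMonoidAlgebra M α R)).sum := by
  rw [e_def, e_def, single_mul_single, one_mul, one_smul]; rfl

/-- The unit `X⁰ · ∅`. [folklore] -/
instance instOne : One (ShuffleMonoidAlgebra M α R) := ⟨e 0 []⟩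

/-- `1 = e 0 []`. [folklore] -/
theorem one_def : (1 : ShuffleMonoidAlgebra M α R) = e 0 [] := rfl

/-- Left distributivity (bilinearity). [folklore] -/
protected theorem mul_add (x y z : ShuffleMonoidAlgebra M α R) : x * (y + z) = x * y + x * z := by
  simp only [mul_def, map_add]

/-- Right distributivity (bilinearity). [folklore] -/
protected theorem add_mul (x y z : ShuffleMonoidAlgebra M α R) : (x + y) * z = x * z + y * z := by
  simp only [mul_def, map_add, LinearMap.add_apply]

/-- `0 * x = 0`. [folklore] -/
protected theorem zero_mul (x : ShuffleMonoidAlgebra M α R) : 0 * x = 0 := by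
  simp only [mul_def, map_zero, LinearMap.zero_apply]

/-- `x * 0 = 0`. [folklore] -/
protected theorem mul_zero (x : ShuffleMonoidAlgebra M α R) : x * 0 = 0 := by
  simp only [mul_def, map_zero]

/-- `(r • x) * y = r • (x * y)`. [folklore] -/
protected theorem smul_mul (r : R) (x y : ShuffleMonoidAlgebra M α R) :
    (r • x) * y = r • (x * y) := by
  simp only [mul_def, map_smul, LinearMap.smul_apply]

/-- `x * (r • y) = r • (x * y)`. [folklore] -/
protected theorem mul_smul (r : R) (x y : ShuffleMonoidAlgebra M α R) :
    x * (r • y) = r • (x * y) := by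
  simp only [mul_def, map_smul]

/-- A list sum times an element. [folklore] -/
protected theorem list_sum_mul {ι : Type*} (L : List ι) (f : ι → ShuffleMonoidAlgebra M α R)
    (y : ShuffleMonoidAlgebra M α R) : (L.map f).sum * y = (L.map fun i => f i * y).sum := by
  induction L with
  | nil => exact ShuffleMonoidAlgebra.zero_mul y
  | cons i L ih => rw [List.map_cons, List.sum_cons, ShuffleMonoidAlgebra.add_mul, ih, List.map_cons,
      List.sum_cons]

/-- An element times a list sum. [folklore] -/
protected theorem mul_list_sum {ι : Type*} (x : ShuffleMonoidAlgebra M α R) (L : List ι)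
    (f : ι → ShuffleMonoidAlgebra M α R) : x * (L.map f).sum = (L.map fun i => x * f i).sum := by
  induction L with
  | nil => exact ShuffleMonoidAlgebra.mul_zero x
  | cons i L ih => rw [List.map_cons, List.sum_cons, ShuffleMonoidAlgebra.mul_add, ih, List.map_cons,
      List.sum_cons]

/-- `e m u * single q s = s • mulBasis (m, u) q`. [folklore] -/
theorem e_mul_single (m : M) (u : List α) (q : M × List α) (s : R) :
    (e m u : ShuffleMonoidAlgebra M α R) * single q s = s • mulBasis (m, u) q := by
  rw [e_def, single_mul_single, one_mul]

/-- `single p r * e m' v = r • mulBasis p (m', v)`. [folklore] -/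
theorem single_mul_e (p : M × List α) (r : R) (m' : M) (v : List α) :
    single p r * (e m' v : ShuffleMonoidAlgebra M α R) = r • mulBasis p (m', v) := by
  rw [e_def, single_mul_single, mul_one]

/-- Associativity on symbols. [cite: Reutenauer1993, §1.4] -/
theorem single_mul_single_mul_single (p q k : M × List α) (r s t : R) :
    (single p r * single q s * single k t : ShuffleMonoidAlgebra M α R) =
      single p r * (single q s * single k t) := by
  obtain ⟨m₁, a⟩ := p; obtain ⟨m₂, b⟩ := q; obtain ⟨m₃, c⟩ := k
  rw [single_mul_single, single_mul_single, ShuffleMonoidAlgebra.smul_mul,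
    ShuffleMonoidAlgebra.mul_smul]
  simp only [mulBasis, ShuffleMonoidAlgebra.list_sum_mul, ShuffleMonoidAlgebra.mul_list_sum,
    e_mul_single, single_mul_e, List.smul_sum, List.map_map, Function.comp_def, smul_smul]
  rw [show s * t * r = r * s * t by ring,
    ← ShuffleAlgebra.sum_map_flatMap (MZV.shuffleWord a b) (fun w => MZV.shuffleWord w c)
      (fun w => (r * s * t) • (e (m₁ + m₂ + m₃) w : ShuffleMonoidAlgebra M α R)),
    ← ShuffleAlgebra.sum_map_flatMap (MZV.shuffleWord b c) (fun w => MZV.shuffleWord a w)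
      (fun w => (r * s * t) • (e (m₁ + (m₂ + m₃)) w : ShuffleMonoidAlgebra M α R)), add_assoc]
  exact ((MZV.shuffleWord_flatMap_perm a b c).map _).sum_eq

/-- Commutativity on symbols. [cite: Reutenauer1993, §1.4] -/
theorem single_mul_single_comm (p q : M × List α) (r s : R) :
    (single p r * single q s : ShuffleMonoidAlgebra M α R) = single q s * single p r := by
  obtain ⟨m₁, a⟩ := p; obtain ⟨m₂, b⟩ := q
  rw [single_mul_single, single_mul_single, mul_comm r s]
  congr 1
  simp only [mulBasis, add_comm m₁ m₂]
  exact ((MZV.shuffleWord_perm_swap a b).map _).sum_eq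

/-- The shuffle product is associative. [cite: Reutenauer1993, §1.4] -/
protected theorem mul_assoc (x y z : ShuffleMonoidAlgebra M α R) : x * y * z = x * (y * z) := by
  induction x using ShuffleMonoidAlgebra.induction_linear with
  | h0 => simp only [ShuffleMonoidAlgebra.zero_mul]
  | hadd x x' hx hx' => simp only [ShuffleMonoidAlgebra.add_mul, hx, hx']
  | hsingle p r =>
    induction y using ShuffleMonoidAlgebra.induction_linear with
    | h0 => simp only [ShuffleMonoidAlgebra.zero_mul, ShuffleMonoidAlgebra.mul_zero]
    | hadd y y' hy hy' =>
      simp only [ShuffleMonoidAlgebra.add_mul, ShuffleMonoidAlgebra.mul_add, hy, hy']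
    | hsingle q s =>
      induction z using ShuffleMonoidAlgebra.induction_linear with
      | h0 => simp only [ShuffleMonoidAlgebra.mul_zero]
      | hadd z z' hz hz' => simp only [ShuffleMonoidAlgebra.mul_add, hz, hz']
      | hsingle k t => exact single_mul_single_mul_single p q k r s t

/-- The shuffle product is commutative. [cite: Reutenauer1993, §1.4] -/
protected theorem mul_comm (x y : ShuffleMonoidAlgebra M α R) : x * y = y * x := by
  induction x using ShuffleMonoidAlgebra.induction_linear with
  | h0 => simp only [ShuffleMonoidAlgebra.zero_mul, ShuffleMonoidAlgebra.mul_zero]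
  | hadd x x' hx hx' => simp only [ShuffleMonoidAlgebra.add_mul, ShuffleMonoidAlgebra.mul_add, hx, hx']
  | hsingle p r =>
    induction y using ShuffleMonoidAlgebra.induction_linear with
    | h0 => simp only [ShuffleMonoidAlgebra.zero_mul, ShuffleMonoidAlgebra.mul_zero]
    | hadd y y' hy hy' =>
      simp only [ShuffleMonoidAlgebra.add_mul, ShuffleMonoidAlgebra.mul_add, hy, hy']
    | hsingle q s => exact single_mul_single_comm p q r s

/-- `1 * x = x`. [folklore] -/
protected theorem one_mul (x : ShuffleMonoidAlgebra M α R) : 1 * x = x := by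
  induction x using ShuffleMonoidAlgebra.induction_linear with
  | h0 => exact ShuffleMonoidAlgebra.mul_zero 1
  | hadd x x' hx hx' => rw [ShuffleMonoidAlgebra.mul_add, hx, hx']
  | hsingle p r =>
    obtain ⟨m, a⟩ := p
    rw [one_def, e_mul_single, mulBasis, MZV.shuffleWord_nil_left, List.map_singleton,
      List.sum_singleton, zero_add, smul_e]

/-- `x * 1 = x`. [folklore] -/
protected theorem mul_one (x : ShuffleMonoidAlgebra M α R) : x * 1 = x := by
  rw [ShuffleMonoidAlgebra.mul_comm]; exact ShuffleMonoidAlgebra.one_mul x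

/-- **The shuffle monoid algebra is a commutative ring.** [cite: Reutenauer1993, §1.4] -/
instance instCommRing : CommRing (ShuffleMonoidAlgebra M α R) where
  __ := (inferInstance : AddCommGroup (ShuffleMonoidAlgebra M α R))
  zero_mul := ShuffleMonoidAlgebra.zero_mul
  mul_zero := ShuffleMonoidAlgebra.mul_zero
  one_mul := ShuffleMonoidAlgebra.one_mul
  mul_one := ShuffleMonoidAlgebra.mul_one
  mul_assoc := ShuffleMonoidAlgebra.mul_assoc
  mul_comm := ShuffleMonoidAlgebra.mul_comm
  left_distrib := ShuffleMonoidAlgebra.mul_add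
  right_distrib := ShuffleMonoidAlgebra.add_mul

/-- **It is a commutative `R`-algebra** (the coefficientwise scalar action). [folklore] -/
instance instAlgebra : Algebra R (ShuffleMonoidAlgebra M α R) :=
  Algebra.ofModule ShuffleMonoidAlgebra.smul_mul ShuffleMonoidAlgebra.mul_smul

/-- `algebraMap r = single (0, ∅) r`. [folklore] -/
theorem algebraMap_apply (r : R) :
    algebraMap R (ShuffleMonoidAlgebra M α R) r = single (0, []) r := by
  rw [Algebra.algebraMap_eq_smul_one, one_def, smul_e]

/-! ### The universal property: table characters extend to algebra homomorphisms -/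

section lift

variable {A : Type*} [CommRing A] [Algebra R A]

/-- The linear extension of `f : M × List α → A` (`single p r ↦ r • f p`). [folklore] -/
def liftLin (f : M × List α → A) : ShuffleMonoidAlgebra M α R →ₗ[R] A :=
  Finsupp.linearCombination R f ∘ₗ toFinsuppL.toLinearMap

/-- `liftLin f (single p r) = r • f p`. [folklore] -/
@[simp] theorem liftLin_single (f : M × List α → A) (p : M × List α) (r : R) :
    liftLin (R := R) f (single p r) = r • f p := by
  rw [liftLin, LinearMap.comp_apply, LinearEquiv.coe_toLinearMap, toFinsuppL_apply,
    toFinsupp_single, Finsupp.linearCombination_single]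

/-- `liftLin f (e m w) = f (m, w)`. [folklore] -/
@[simp] theorem liftLin_e (f : M × List α → A) (m : M) (w : List α) :
    liftLin (R := R) f (e m w) = f (m, w) := by
  rw [e_def, liftLin_single, one_smul]

/-- `liftLin f` of a list sum of basis vectors. [folklore] -/
theorem liftLin_list_sum_e (f : M × List α → A) (m : M) (L : List (List α)) :
    liftLin (R := R) f ((L.map fun w => (e m w : ShuffleMonoidAlgebra M α R)).sum) =
      (L.map fun w => f (m, w)).sum := by
  rw [map_list_sum, List.map_map]
  exact congrArg List.sum (List.map_congr_left fun w _ => liftLin_e f m w)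

/-- **A table character is multiplicative on the whole algebra**: if
`f p f q = Σ_{w ∈ p₂ ш q₂} f (p₁ + q₁, w)` then its linear extension is multiplicative.
[cite: Reutenauer1993, §1.4] -/
theorem liftLin_mul (f : M × List α → A)
    (hmul : ∀ p q : M × List α,
      f p * f q = ((MZV.shuffleWord p.2 q.2).map fun w => f (p.1 + q.1, w)).sum)
    (x y : ShuffleMonoidAlgebra M α R) :
    liftLin (R := R) f (x * y) = liftLin (R := R) f x * liftLin (R := R) f y := by
  induction x using ShuffleMonoidAlgebra.induction_linear with
  | h0 => rw [zero_mul, map_zero, zero_mul]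
  | hadd x x' hx hx' => rw [add_mul, map_add, map_add, hx, hx', add_mul]
  | hsingle p r =>
    induction y using ShuffleMonoidAlgebra.induction_linear with
    | h0 => rw [mul_zero, map_zero, mul_zero]
    | hadd y y' hy hy' => rw [mul_add, map_add, map_add, hy, hy', mul_add]
    | hsingle q s =>
      rw [single_mul_single, map_smul, liftLin_single, liftLin_single, mulBasis,
        liftLin_list_sum_e, ← hmul, smul_mul_assoc, mul_smul_comm, smul_smul]

/-- **The universal property of the shuffle monoid algebra**: a table character
(`f (0, ∅) = 1`, `f p f q = Σ_{w ∈ p₂ ш q₂} f (p₁ + q₁, w)`) extends to an `R`-algebra homomorphism.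
[cite: Reutenauer1993, §1.4] -/
def lift (f : M × List α → A) (h1 : f (0, []) = 1)
    (hmul : ∀ p q : M × List α,
      f p * f q = ((MZV.shuffleWord p.2 q.2).map fun w => f (p.1 + q.1, w)).sum) :
    ShuffleMonoidAlgebra M α R →ₐ[R] A :=
  AlgHom.ofLinearMap (liftLin f) (by rw [one_def, liftLin_e, h1]) (liftLin_mul f hmul)

/-- `lift f (single p r) = r • f p`. [folklore] -/
@[simp] theorem lift_single (f : M × List α → A) (h1 : f (0, []) = 1)
    (hmul : ∀ p q : M × List α,
      f p * f q = ((MZV.shuffleWord p.2 q.2).map fun w => f (p.1 + q.1, w)).sum)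
    (p : M × List α) (r : R) : lift (R := R) f h1 hmul (single p r) = r • f p :=
  liftLin_single f p r

/-- `lift f (e m w) = f (m, w)`. [folklore] -/
@[simp] theorem lift_e (f : M × List α → A) (h1 : f (0, []) = 1)
    (hmul : ∀ p q : M × List α,
      f p * f q = ((MZV.shuffleWord p.2 q.2).map fun w => f (p.1 + q.1, w)).sum)
    (m : M) (w : List α) : lift (R := R) f h1 hmul (e m w) = f (m, w) :=
  liftLin_e f m w

/-- `lift f x = Σ_{p ∈ supp x} x(p) • f p`. [folklore] -/
theorem lift_apply (f : M × List α → A) (h1 : f (0, []) = 1)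
    (hmul : ∀ p q : M × List α,
      f p * f q = ((MZV.shuffleWord p.2 q.2).map fun w => f (p.1 + q.1, w)).sum)
    (x : ShuffleMonoidAlgebra M α R) :
    lift (R := R) f h1 hmul x = ∑ p ∈ x.toFinsupp.support, x p • f p := by
  conv_lhs => rw [← sum_single x]
  rw [map_sum]
  exact Finset.sum_congr rfl fun p _ => lift_single f h1 hmul p (x p)

end lift

/-! ### The prefix derivations `ᵦ∂`: remove an initial letter -/

omit [AddCommMonoid M] in
/-- Prefixing the word component by the letter `b` is injective. [folklore] -/
theorem consLetter_injective (b : α) :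
    Function.Injective fun p : M × List α => (p.1, b :: p.2) := by
  rintro ⟨m, w⟩ ⟨m', w'⟩ h
  simp only [Prod.mk.injEq, List.cons.injEq, true_and] at h
  exact Prod.ext h.1 h.2

/-- **The operator `ᵦ∂` "remove the initial letter `b`"**: `(ᵦ∂ x)(m, w) = x(m, b w)` — for
`M = ℕ`, `α = ℕ`, `b = 2r+1` this is Brown's `∂_{2r+1} = (f^∨_{2r+1} ⊗ id) ∘ Δ'` on `𝒰`
(deconcatenation of the initial letter; `BrownDepthOneLift.dU`).
[cite: Brown2012, (2.20) and proof of Lemma 2.7] -/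
def D (b : α) : ShuffleMonoidAlgebra M α R →ₗ[R] ShuffleMonoidAlgebra M α R :=
  toFinsuppL.symm.toLinearMap ∘ₗ
    Finsupp.lcomapDomain (fun p : M × List α => (p.1, b :: p.2)) (consLetter_injective b) ∘ₗ
      toFinsuppL.toLinearMap

/-- `(ᵦ∂ x)(m, w) = x(m, b w)`. [folklore] -/
@[simp] theorem D_apply (b : α) (x : ShuffleMonoidAlgebra M α R) (p : M × List α) :
    D b x p = x (p.1, b :: p.2) := rfl

/-- `ᵦ∂ (X^m · b w) = X^m · w`. [folklore] -/
theorem D_e_cons (b : α) (m : M) (w : List α) :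
    D b (e m (b :: w) : ShuffleMonoidAlgebra M α R) = e m w := by
  classical
  ext ⟨m', w'⟩
  rw [D_apply, e_def, e_def, single_apply, single_apply]
  simp only [Prod.mk.injEq, List.cons.injEq, true_and]

/-- `ᵦ∂ (X^m · w) = 0` if `w` does not begin with `b` (including `w = ∅`). [folklore] -/
theorem D_e_of_ne (b : α) (m : M) {w : List α} (h : w.head? ≠ some b) :
    D b (e m w : ShuffleMonoidAlgebra M α R) = 0 := by
  classical
  ext ⟨m', w'⟩
  rw [D_apply, e_def, single_apply, zero_apply, if_neg]
  rintro ⟨rfl, rfl⟩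
  exact h rfl

/-- `ᵦ∂` on a sum of basis vectors with a letter `x` prefixed: `[x = b] ·` the sum. [folklore] -/
theorem D_list_sum_e_cons [DecidableEq α] (b x : α) (m : M) (L : List (List α)) :
    D b ((L.map fun w => (e m (x :: w) : ShuffleMonoidAlgebra M α R)).sum) =
      if x = b then (L.map fun w => (e m w : ShuffleMonoidAlgebra M α R)).sum else 0 := by
  rw [map_list_sum, List.map_map]
  by_cases hxb : x = b
  · subst hxb
    rw [if_pos rfl]
    exact congrArg List.sum (List.map_congr_left fun w _ => D_e_cons x m w)
  · rw [if_neg hxb]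
    exact List.sum_eq_zero fun y hy => by
      obtain ⟨w, -, rfl⟩ := List.mem_map.1 hy
      exact D_e_of_ne b m (by simpa using hxb)

/-- `X^m · ∅` is the scalar... the unit rescaled: `e m ∅ * y` has `e 0 ∅ = 1`; here only `m = 0`
is needed: `e 0 ∅ = 1`. [folklore] -/
theorem e_zero_nil : (e 0 ([] : List α) : ShuffleMonoidAlgebra M α R) = 1 := rfl

/-- `e m ∅ * e m' v = e (m + m') v`. [folklore] -/
theorem e_nil_mul_e (m m' : M) (v : List α) :
    (e m ([] : List α) * e m' v : ShuffleMonoidAlgebra M α R) = e (m + m') v := by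
  rw [e_mul_e, MZV.shuffleWord_nil_left, List.map_singleton, List.sum_singleton]

/-- `e m u * e m' ∅ = e (m + m') u`. [folklore] -/
theorem e_mul_e_nil (m m' : M) (u : List α) :
    (e m u * e m' ([] : List α) : ShuffleMonoidAlgebra M α R) = e (m + m') u := by
  rw [e_mul_e, MZV.shuffleWord_nil_right, List.map_singleton, List.sum_singleton]

/-- The Leibniz rule on basis vectors (the first letter of a shuffle comes from one of the two
factors). [folklore] -/
theorem D_e_mul_e [DecidableEq α] (b : α) (m m' : M) : ∀ (u v : List α),
    D b ((e m u : ShuffleMonoidAlgebra M α R) * e m' v) = D b (e m u) * e m' v + e m u * D b (e m' v)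
  | [], [] => by
    rw [D_e_of_ne b m (w := []) (by simp), zero_mul, zero_add, e_mul_e_nil, D_e_of_ne b _ (by simp),
      D_e_of_ne b _ (by simp), mul_zero]
  | [], y :: v => by
    rw [D_e_of_ne b m (w := []) (by simp), zero_mul, zero_add, e_nil_mul_e]
    by_cases hyb : y = b
    · subst hyb; rw [D_e_cons, D_e_cons, e_nil_mul_e]
    · rw [D_e_of_ne b _ (w := y :: v) (by simpa using hyb),
        D_e_of_ne b _ (w := y :: v) (by simpa using hyb), mul_zero]
  | x :: u, [] => by
    rw [D_e_of_ne b m' (w := []) (by simp), mul_zero, add_zero, e_mul_e_nil]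
    by_cases hxb : x = b
    · subst hxb; rw [D_e_cons, D_e_cons, e_mul_e_nil]
    · rw [D_e_of_ne b _ (w := x :: u) (by simpa using hxb),
        D_e_of_ne b _ (w := x :: u) (by simpa using hxb), zero_mul]
  | x :: u, y :: v => by
    rw [e_mul_e, MZV.shuffleWord_cons_cons, List.map_append, List.sum_append, map_add,
      List.map_map, List.map_map, Function.comp_def, Function.comp_def, D_list_sum_e_cons,
      D_list_sum_e_cons]
    congr 1
    · by_cases hxb : x = b
      · subst hxb; rw [if_pos rfl, D_e_cons, e_mul_e]
      · rw [if_neg hxb, D_e_of_ne b m (w := x :: u) (by simpa using hxb), zero_mul]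
    · by_cases hyb : y = b
      · subst hyb; rw [if_pos rfl, D_e_cons, e_mul_e]
      · rw [if_neg hyb, D_e_of_ne b m' (w := y :: v) (by simpa using hyb), mul_zero]

/-- **`ᵦ∂` is a derivation of the shuffle monoid algebra.** [folklore] -/
theorem D_mul (b : α) (x y : ShuffleMonoidAlgebra M α R) :
    D b (x * y) = D b x * y + x * D b y := by
  classical
  induction x using ShuffleMonoidAlgebra.induction_linear with
  | h0 => simp only [zero_mul, map_zero, zero_add]
  | hadd x x' hx hx' => rw [add_mul, map_add, map_add, hx, hx', add_mul, add_mul]; abel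
  | hsingle p r =>
    induction y using ShuffleMonoidAlgebra.induction_linear with
    | h0 => simp only [mul_zero, map_zero, add_zero]
    | hadd y y' hy hy' => rw [mul_add, map_add, map_add, hy, hy', mul_add, mul_add]; abel
    | hsingle q s =>
      obtain ⟨m, u⟩ := p; obtain ⟨m', v⟩ := q
      rw [← smul_e r m u, ← smul_e s m' v, smul_mul_assoc, mul_smul_comm, map_smul, map_smul,
        D_e_mul_e, smul_add, smul_add, map_smul, map_smul, smul_mul_assoc, mul_smul_comm,
        smul_mul_assoc, mul_smul_comm]

/-- `ᵦ∂` kills the letter-free elements `X^m · ∅`. [folklore] -/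
theorem D_e_nil (b : α) (m : M) : D b (e m ([] : List α) : ShuffleMonoidAlgebra M α R) = 0 :=
  D_e_of_ne b m (by simp)

/-! ### Supports of products -/

/-- A list sum with a nonzero value has a nonzero term. [folklore] -/
theorem exists_mem_ne_zero_of_list_sum_ne_zero {ι N : Type*} [AddMonoid N] {L : List ι}
    {f : ι → N} (h : (L.map f).sum ≠ 0) : ∃ i ∈ L, f i ≠ 0 := by
  by_contra hne
  push Not at hne
  exact h (List.sum_eq_zero fun n hn => by
    obtain ⟨i, hi, rfl⟩ := List.mem_map.1 hn
    exact hne i hi)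

/-- **A nonzero coefficient of a product sits at a shuffle of the supports**: if
`(x y)(m'', w) ≠ 0` then `m'' = m + m'` and `w ∈ u ш v` for some `(m, u)` in the support of `x` and
`(m', v)` in the support of `y`. [cite: Reutenauer1993, §1.4] -/
theorem exists_of_mul_apply_ne_zero {x y : ShuffleMonoidAlgebra M α R} {k : M × List α}
    (h : (x * y) k ≠ 0) :
    ∃ p, x p ≠ 0 ∧ ∃ q, y q ≠ 0 ∧ k.1 = p.1 + q.1 ∧ k.2 ∈ MZV.shuffleWord p.2 q.2 := by
  classical
  rw [← sum_single x, ← sum_single y, Finset.sum_mul_sum, finset_sum_apply] at h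
  obtain ⟨p, hp, hne₁⟩ := Finset.exists_ne_zero_of_sum_ne_zero h
  rw [finset_sum_apply] at hne₁
  obtain ⟨q, hq, hne⟩ := Finset.exists_ne_zero_of_sum_ne_zero hne₁
  rw [Finsupp.mem_support_iff] at hp hq
  refine ⟨p, hp, q, hq, ?_⟩
  rw [single_mul_single, smul_apply, mulBasis, list_sum_apply] at hne
  obtain ⟨w, hw, hw'⟩ := exists_mem_ne_zero_of_list_sum_ne_zero (right_ne_zero_of_mul hne)
  rw [e_def, single_apply] at hw'
  split_ifs at hw' with hk
  · subst hk; exact ⟨rfl, hw⟩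
  · exact absurd rfl hw'

/-- The coefficient of a product at `(m'', w)` vanishes unless `w` is a shuffle of words in the
supports. Contrapositive form of `exists_of_mul_apply_ne_zero`. [folklore] -/
theorem mul_apply_eq_zero_of_forall {x y : ShuffleMonoidAlgebra M α R} {k : M × List α}
    (h : ∀ p, x p ≠ 0 → ∀ q, y q ≠ 0 → k.1 = p.1 + q.1 → k.2 ∉ MZV.shuffleWord p.2 q.2) :
    (x * y) k = 0 := by
  by_contra hk
  obtain ⟨p, hp, q, hq, h1, h2⟩ := exists_of_mul_apply_ne_zero hk
  exact h p hp q hq h1 h2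

end ShuffleMonoidAlgebra

end Literature.NumberTheory.Transcendental
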